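import Summits.CriticalPhenomena.PercolationContinuityZ3.Theorems.PercNearOneGluingNoHeavyQuantFarSunCertLayer
import HarnessLib

/-!
# FAR beyond trees: bookkeeping for the SUPPORT LEMMA of reached-set-level certificates (`TK.support_lemma`, next file)

builds on p205010 (kernel theorem, internal audit signed; external expert review pending)

Support file (`--supports stmt-CriticalPhenomena-4575`), seat `prim-cert-1` (gen 30); memo `prim-cert-1/FROM-prim-cert-1-g30-SUPPORT-LEMMA.md`.
Setting of `TK.sunFAR_of_layerCert` (`…QuantFarSunCertLayer`): the pair function `TK.Fgen K j a b` and its symmetrisation `TK.Wgen`.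
For a set `ω ⊆ range K` with more than `j` elements ("window") and its complement `Q = range K ∖ ω` with exactly `j` elements, this file
evaluates `W` on the pairs that occur in the three orbit families of the support lemma once some entries of the certificate are known to
vanish: `W(range K, X)`, `W(range K, S)`, `W(X, Q)`, `W(S, Q)` for `X ⊇ ω`, `S ⊆ Q`, and `W = 0` for pairs of sets that already satisfy the lemma.
* `TK.Fgen_large` / `TK.Fgen_small` — `F(X;Y)` on a copy with more / at most `j` relays;
* `TK.cov_top`, `TK.cov_zero_right`, `TK.cov_window` — `cov K (K+1) u = cov K l 0 = range K`, `cov K s (s+L) = range K ∖ [s, s+L)`;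
* `TK.sum_out_eq_zero`, `TK.sum_in_eq_zero`, `TK.sum_full_eq_zero`, `TK.sum_in_nonneg`, `TK.zero_of_sum_in` — sums of `a` over / off a set;
* `TK.W_full_large`, `TK.W_full_small`, `TK.W_large_Q`, `TK.W_small_Q`, `TK.W_zero_ll`, `TK.W_zero_ls`, `TK.W_zero_ss` — the evaluations.
Elementary [this work]; no sorries, standard axioms.
-/

namespace Summit.CriticalPhenomena.PercolationContinuityZ3.Theorems.HairyCycle

namespace TK

open Finset

variable {K j : ℕ} {a : ℕ → Finset ℕ → ℤ} {b : Finset ℕ → ℤ}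

/-! ### The pair function on large and small copies; three coverage sets -/

/-- `F(X;Y)` when the copy `X` has more than `j` relays: `Σ_{k<K, k∉X} a_k(Y) − b(Y)(|X| − 2j)`. [this work] -/
theorem Fgen_large {X Y : Finset ℕ} (h : j < X.card) :
    Fgen K j a b X Y = (∑ k ∈ range K, if k ∉ X then a k Y else 0) - b Y * ((X.card : ℤ) - 2 * j) := by
  unfold Fgen
  have hX : ¬ X.card ≤ j := not_le.2 h
  simp only [hX, if_false, sub_zero]
  congr 1
  refine Finset.sum_congr rfl fun k _ => ?_
  split_ifs <;> simp

/-- `F(X;Y)` when the copy `X` has at most `j` relays: `−Σ_{k<K, k∈X} a_k(Y) − b(Y)(|X| − 2j)`. [this work] -/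
theorem Fgen_small {X Y : Finset ℕ} (h : X.card ≤ j) :
    Fgen K j a b X Y = -(∑ k ∈ range K, if k ∈ X then a k Y else 0) - b Y * ((X.card : ℤ) - 2 * j) := by
  unfold Fgen
  simp only [h, if_true]
  rw [← Finset.sum_neg_distrib]
  congr 1
  refine Finset.sum_congr rfl fun k _ => ?_
  by_cases hk : k ∈ X
  · simp [hk]
  · simp [hk]

/-- Full clockwise coverage: `cov K (K+1) u = range K`. [this work] -/
theorem cov_top (u : ℕ) : cov K (K + 1) u = range K := by
  ext k; rw [mem_cov, mem_range]; omega

/-- Full counter-clockwise coverage: `cov K l 0 = range K`. [this work] -/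
theorem cov_zero_right (l : ℕ) : cov K l 0 = range K := by
  ext k; rw [mem_cov, mem_range]; omega

/-- The complement of a window is an arc-complement set: `cov K s (s+L) = range K ∖ [s, s+L)`. [this work] -/
theorem cov_window (s L : ℕ) : cov K s (s + L) = range K \ Ico s (s + L) := by
  ext k; rw [mem_cov, mem_sdiff, mem_range, mem_Ico]; omega

/-! ### Sums of `a` over / off a set -/

/-- Off-`X` sum of `a_·(Y')` vanishes when `X ⊇ ω` and `a_k(Y') = 0` on `Q = range K ∖ ω`. [this work] -/
theorem sum_out_eq_zero {ω Q X Y' : Finset ℕ} (hQ : ∀ k, k ∈ Q ↔ k < K ∧ k ∉ ω) (hX : ω ⊆ X)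
    (hz : ∀ k ∈ Q, a k Y' = 0) : (∑ k ∈ range K, if k ∉ X then a k Y' else 0) = 0 := by
  refine Finset.sum_eq_zero fun k hk => ?_
  by_cases h1 : k ∈ X
  · rw [if_neg (not_not.2 h1)]
  · rw [if_pos h1]; exact hz k ((hQ k).2 ⟨mem_range.1 hk, fun h2 => h1 (hX h2)⟩)

/-- In-`S` sum of `a_·(X')` vanishes when `S ⊆ Q` and `a_k(X') = 0` on `Q`. [this work] -/
theorem sum_in_eq_zero {Q S X' : Finset ℕ} (hS : S ⊆ Q) (hz : ∀ k ∈ Q, a k X' = 0) :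
    (∑ k ∈ range K, if k ∈ S then a k X' else 0) = 0 := by
  refine Finset.sum_eq_zero fun k _ => ?_
  by_cases h1 : k ∈ S
  · rw [if_pos h1]; exact hz k (hS h1)
  · rw [if_neg h1]

/-- Nothing lies outside the full copy. [this work] -/
theorem sum_full_eq_zero (Y' : Finset ℕ) : (∑ k ∈ range K, if k ∉ range K then a k Y' else 0) = 0 :=
  Finset.sum_eq_zero fun k hk => by rw [if_neg (not_not.2 hk)]

/-- In-`S` sums are nonnegative for a nonnegative `a`. [this work] -/
theorem sum_in_nonneg (ha : ∀ k, ∀ R', R' ⊆ range K → 0 ≤ a k R') (S : Finset ℕ) {X' : Finset ℕ} (hX' : X' ⊆ range K) :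
    0 ≤ ∑ k ∈ range K, (if k ∈ S then a k X' else 0) :=
  Finset.sum_nonneg fun k _ => by split_ifs; exacts [ha k X' hX', le_rfl]

/-- A vanishing in-`S` sum with `S ⊇ Q` kills `a_k(X')` on `Q`. [this work] -/
theorem zero_of_sum_in (ha : ∀ k, ∀ R', R' ⊆ range K → 0 ≤ a k R') {Q S X' : Finset ℕ} (hQK : Q ⊆ range K) (hS : Q ⊆ S)
    (hX' : X' ⊆ range K) (h0 : (∑ k ∈ range K, if k ∈ S then a k X' else 0) = 0) : ∀ k ∈ Q, a k X' = 0 := by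
  intro k hk
  have h1 := (Finset.sum_eq_zero_iff_of_nonneg (fun i _ => by
    split_ifs; exacts [ha i X' hX', le_rfl])).1 h0 k (hQK hk)
  rwa [if_pos (hS hk)] at h1

/-! ### Evaluations of `W` once some zeros are known (`ω` a set with more than `j` elements, `Q = range K ∖ ω` with `j` elements) -/

section Window

variable {ω Q : Finset ℕ} (hωK : ω ⊆ range K) (hQ : ∀ k, k ∈ Q ↔ k < K ∧ k ∉ ω) (hjω : j < ω.card) (hQcard : Q.card = j)

include hQ hjω in
/-- `W(range K, X) = −(K−2j)·b(X)` for `X ⊇ ω`, given `b(range K) = 0` and `a_k(range K) = 0` on `Q`. [this work] -/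
theorem W_full_large (hωK : ω ⊆ range K) {X : Finset ℕ} (hX : ω ⊆ X) (hbf : b (range K) = 0)
    (haf : ∀ k ∈ Q, a k (range K) = 0) : Wgen K j a b (range K) X = -(b X * ((K : ℤ) - 2 * j)) := by
  have hKj : j < (range K).card := lt_of_lt_of_le hjω (card_le_card hωK)
  unfold Wgen
  rw [Fgen_large hKj, sum_full_eq_zero, card_range, Fgen_large (lt_of_lt_of_le hjω (card_le_card hX)),
    sum_out_eq_zero hQ hX haf, hbf]
  ring

include hQ hQcard in
/-- `W(range K, S) = −(K−2j)·b(S)` for `S ⊆ Q`, given the same level-0 facts (`j < K`). [this work] -/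
theorem W_full_small (hjK : j < K) {S : Finset ℕ} (hS : S ⊆ Q) (hbf : b (range K) = 0)
    (haf : ∀ k ∈ Q, a k (range K) = 0) : Wgen K j a b (range K) S = -(b S * ((K : ℤ) - 2 * j)) := by
  have hKj : j < (range K).card := by rwa [card_range]
  have hq := hQ  -- (keeps the membership characterisation in scope for uniformity)
  unfold Wgen
  rw [Fgen_large hKj, sum_full_eq_zero, card_range, Fgen_small ((card_le_card hS).trans hQcard.le),
    sum_in_eq_zero hS haf, hbf]
  ring

include hQ hjω hQcard in
/-- `W(X, Q) = j·b(X) − Σ_{k∈Q} a_k(X)` for `X ⊇ ω`, given `b(Q) = 0` and `a_k(Q) = 0` on `Q`. [this work] -/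
theorem W_large_Q {X : Finset ℕ} (hX : ω ⊆ X) (hbQ : b Q = 0) (haQ : ∀ k ∈ Q, a k Q = 0) :
    Wgen K j a b X Q = b X * ((2 * j : ℤ) - j) - ∑ k ∈ range K, (if k ∈ Q then a k X else 0) := by
  unfold Wgen
  rw [Fgen_large (lt_of_lt_of_le hjω (card_le_card hX)), sum_out_eq_zero hQ hX haQ, hbQ,
    Fgen_small hQcard.le, hQcard]
  ring

include hQcard in
/-- `W(S, Q) = j·b(S) − Σ_{k∈Q} a_k(S)` for `S ⊆ Q`, given `b(Q) = 0` and `a_k(Q) = 0` on `Q`. [this work] -/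
theorem W_small_Q {S : Finset ℕ} (hS : S ⊆ Q) (hbQ : b Q = 0) (haQ : ∀ k ∈ Q, a k Q = 0) :
    Wgen K j a b S Q = b S * ((2 * j : ℤ) - j) - ∑ k ∈ range K, (if k ∈ Q then a k S else 0) := by
  unfold Wgen
  rw [Fgen_small ((card_le_card hS).trans hQcard.le), sum_in_eq_zero hS haQ, hbQ, Fgen_small hQcard.le, hQcard]
  ring

include hQ hjω in
/-- Two sets containing `ω` that both satisfy the lemma pair to `W = 0`. [this work] -/
theorem W_zero_ll {X₁ X₂ : Finset ℕ} (h1 : ω ⊆ X₁) (h2 : ω ⊆ X₂) (hb1 : b X₁ = 0) (hb2 : b X₂ = 0)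
    (ha1 : ∀ k ∈ Q, a k X₁ = 0) (ha2 : ∀ k ∈ Q, a k X₂ = 0) : Wgen K j a b X₁ X₂ = 0 := by
  unfold Wgen
  rw [Fgen_large (lt_of_lt_of_le hjω (card_le_card h1)), Fgen_large (lt_of_lt_of_le hjω (card_le_card h2)),
    sum_out_eq_zero hQ h1 ha2, sum_out_eq_zero hQ h2 ha1, hb1, hb2]
  ring

include hQ hjω hQcard in
/-- A set containing `ω` and a subset of `Q` that both satisfy the lemma pair to `W = 0`. [this work] -/
theorem W_zero_ls {X₁ S : Finset ℕ} (h1 : ω ⊆ X₁) (h2 : S ⊆ Q) (hb1 : b X₁ = 0) (hb2 : b S = 0)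
    (ha1 : ∀ k ∈ Q, a k X₁ = 0) (ha2 : ∀ k ∈ Q, a k S = 0) : Wgen K j a b X₁ S = 0 := by
  unfold Wgen
  rw [Fgen_large (lt_of_lt_of_le hjω (card_le_card h1)), Fgen_small ((card_le_card h2).trans hQcard.le),
    sum_out_eq_zero hQ h1 ha2, sum_in_eq_zero h2 ha1, hb1, hb2]
  ring

include hQcard in
/-- Two subsets of `Q` that both satisfy the lemma pair to `W = 0`. [this work] -/
theorem W_zero_ss {S₁ S₂ : Finset ℕ} (h1 : S₁ ⊆ Q) (h2 : S₂ ⊆ Q) (hb1 : b S₁ = 0) (hb2 : b S₂ = 0)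
    (ha1 : ∀ k ∈ Q, a k S₁ = 0) (ha2 : ∀ k ∈ Q, a k S₂ = 0) : Wgen K j a b S₁ S₂ = 0 := by
  unfold Wgen
  rw [Fgen_small ((card_le_card h1).trans hQcard.le), Fgen_small ((card_le_card h2).trans hQcard.le),
    sum_in_eq_zero h1 ha2, sum_in_eq_zero h2 ha1, hb1, hb2]
  ring

end Window

end TK

end Summit.CriticalPhenomena.PercolationContinuityZ3.Theorems.HairyCycle
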